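import Summits.RiemannHypothesis.RiemannHypothesis.Theorems.PfPersistenceF6LadderSkew

/-!
# Pf-persistence, fake seat 6 (gen 3): the PF-C4 middle-gap reader is also a first-gap floor

mechanism/rigidity campaign; no RH claims.

The pf seat's corridor conjunct PF-C4 asks that the MIDDLE log-gap `g₂ = lg (e₂/o₁)` does not drop by more than
`c = 1/2` dex from a window `w` to its successor `w⁺`: in log coordinates `pfC4 c l l' : l 2 - l 1 - c ≤ l' 2 - l' 1`.
If the successor ladder is VALID (`logLadder κ l'`), its `mag` tolerance gives `g₂(l') ≤ g₁(l') + κ`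
(`logLadder_gap_two_le`, p191690), so PF-C4 — exactly like cand-8's forward gap rigidity
(`gapRigid_firstGap_lower`, p191690) — is a requirement on the successor's FIRST gap alone:
`g₁(l') ≥ g₂(l) - c - κ`.  Both rigidity readers of the campaign's corridor therefore reduce, on the K2 look-ahead
family, to one typed quantity, the next window's first gap `lg (o₁/|e₁|)(w⁺)`; fake-6's adversarial row
C8-N7(f)/(g) measures its supremum over weight-only dial twins (`≈ 1.25–1.39` dex, DATA-model) against the floors
these lemmas compute (`≥ 1.45` for PF-C4 at the smallest measured middle gap `g₂(w) = 2.2`, `≥ 2.5` at the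
certified members' `g₂(w) ≥ 3.2`; `≥ 1.93` for gap rigidity at `ρ = 0.96` and span `≥ 6.8`).

* `pfC4` — the reader as a `Prop` on two log-ladders.
* `pfC4_firstGap_lower` — PROVED: `pfC4 c l l' → logLadder κ l' → l 2 - l 1 - c - κ ≤ l' 1 - l' 0`.
* `not_pfC4_of_firstGap_small` — PROVED: contrapositive form used by the row.
* `pfC4_floor_tight` — PROVED: the floor is attained (for every middle gap `G > c + κ`, `0 ≤ κ`), so nothing
  sharper follows from LADDER + PF-C4 alone.
* `corridor_firstGap_lower` — PROVED: the two readers side by side (gap rigidity at `ρ` and PF-C4 at `c`) as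
  first-gap floors under one valid successor ladder.
* `pfC4_tripwire` — PROVED closed instance with the numbers of record: `κ = 1/4`, `c = 1/2`, current middle gap
  `≥ 2.2` dex, successor first gap `≤ 1.4` dex ⇒ `¬ pfC4 (1/2) l l'`.

Elementary real (in)equalities on four-term log-ladders; nothing refers to ζ, the explicit formula, or RH. [folklore]
-/

namespace Summit.RiemannHypothesis.RiemannHypothesis.Theorems.PfPersistence.F6

/-- The PF-C4 corridor reader in log coordinates: the middle gap `l 2 - l 1 = lg (e₂/o₁)` drops by at most `c`
from the current window's ladder `l` to the successor's `l'`. -/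
def pfC4 (c : ℝ) (l l' : ℕ → ℝ) : Prop :=
  l 2 - l 1 - c ≤ l' 2 - l' 1

/-- PROVED: PF-C4 into a VALID successor ladder forces the successor's first gap:
`g₂(l) - c - κ ≤ g₁(l')`. [folklore] -/
theorem pfC4_firstGap_lower {c κ : ℝ} {l l' : ℕ → ℝ} (hP : pfC4 c l l') (hL : logLadder κ l') :
    l 2 - l 1 - c - κ ≤ l' 1 - l' 0 := by
  have h2 := logLadder_gap_two_le hL
  unfold pfC4 at hP
  linarith

/-- PROVED: if the successor ladder is valid but its first gap is smaller than `g₂(l) - c - κ`, PF-C4 fails. [folklore] -/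
theorem not_pfC4_of_firstGap_small {c κ : ℝ} {l l' : ℕ → ℝ} (hL : logLadder κ l')
    (hlt : l' 1 - l' 0 < l 2 - l 1 - c - κ) : ¬ pfC4 c l l' :=
  fun hP => absurd (pfC4_firstGap_lower hP hL) (not_le.mpr hlt)

/-- PROVED: the PF-C4 first-gap floor is attained — for every middle gap `G > c + κ` (`0 ≤ κ`) there are ladders
`l`, `l'` with `l'` valid, PF-C4 holding, `g₂(l) = G` and `g₁(l') = G - c - κ` exactly. [folklore] -/
theorem pfC4_floor_tight {c κ G : ℝ} (hκ : 0 ≤ κ) (hG : c + κ < G) :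
    ∃ l l' : ℕ → ℝ, logLadder κ l' ∧ pfC4 c l l' ∧ l 2 - l 1 = G ∧ l' 1 - l' 0 = G - c - κ := by
  refine ⟨fun i => if i = 0 then 0 else if i = 1 then 1 else if i = 2 then 1 + G else 2 + G,
          fun i => if i = 0 then 0 else if i = 1 then G - c - κ else if i = 2 then 2 * (G - c - κ) + κ
                   else 3 * (G - c - κ) + κ, ?_, ?_, ?_, ?_⟩
  · refine ⟨?_, ?_, ?_, ?_, ?_⟩ <;> simp <;> linarith
  · unfold pfC4; simp; linarith
  · simp
  · simp

/-- PROVED: the campaign's two corridor readers side by side — forward gap rigidity at fraction `ρ` (cand8-012) and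
PF-C4 at drop `c` (pf) — are both floors on the successor's FIRST gap once the successor ladder is valid. [folklore] -/
theorem corridor_firstGap_lower {ρ c κ : ℝ} {l l' : ℕ → ℝ} (hL : logLadder κ l') :
    (gapRigid ρ l l' → ρ * (l 3 - l 0) ≤ 3 * (l' 1 - l' 0) + 3 * κ) ∧
    (pfC4 c l l' → l 2 - l 1 - c - κ ≤ l' 1 - l' 0) :=
  ⟨fun hR => gapRigid_firstGap_lower hR hL, fun hP => pfC4_firstGap_lower hP hL⟩

/-- PROVED (numbers of record as a closed instance): harness tolerance `κ = 1/4`, PF-C4 drop `c = 1/2`, a current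
middle gap of at least `2.2` dex (the fourteen certified members have `g₂(w) ∈ [2.26, 3.46]`, the adversarial
maximisers of row C8-N7(f)/(g) `g₂(w) ≥ 2.24` — DATA) and a successor first gap of at most `1.4` dex (certified
members `≤ 1.01`, adversarial supremum `≈ 1.39` — DATA-model) are incompatible with PF-C4. [folklore] -/
theorem pfC4_tripwire {l l' : ℕ → ℝ} (hL : logLadder (1/4) l') (hmid : 2.2 ≤ l 2 - l 1)
    (hg : l' 1 - l' 0 ≤ 1.4) : ¬ pfC4 (1/2) l l' :=
  not_pfC4_of_firstGap_small hL (by norm_num at hmid hg ⊢; linarith)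

end Summit.RiemannHypothesis.RiemannHypothesis.Theorems.PfPersistence.F6
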